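import Literature.AlgebraicGeometry.Resolution.AffineBlowup
import Literature.AlgebraicGeometry.Resolution.AffineBlowupAlgebra
import Mathlib.RingTheory.FiniteType
import Mathlib.RingTheory.Noetherian.Basic
import Mathlib.Algebra.CharP.Algebra
import HarnessLib

/-!
# Chart rings of the affine blowing up are Noetherian domains of characteristic `p`

Support file for crux stmt-ResolutionOfSingularities-15315
(`FrobeniusLadder.FInjectiveMacaulayfication`, line `Sketch`, lead seat c4, cycle 5, wave 1):
stub `stub_reesChartRing` of the §6 BLOW-UP GLUE (E6) package.

For a commutative ring `R`, an ideal `I` and `a ∈ I`, the chart `D₊(at)` of the blowing up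
`Bl_I(Spec R) = Proj R[It]` is `Spec` of the degree-zero localization
`A = (R[It])_{(at)} = HomogeneousLocalization.Away (reesGrading I) (reesT a ha)`, the affine blowup
algebra `R[I/a]` (Stacks Project, Tag 0804). We prove:

* `reesChartBase_injective` — for a domain `R` and `a ≠ 0` the structure map `φ : R → A` is
  injective (`ψ ∘ φ = (R → R[1/a])` with `ψ = reesChart`, and `R → R[1/a]` is injective);
* (reused from `AffineBlowupAlgebra.lean`: `reesChart_injective` — the chart map `ψ : A → R[1/a]`
  is injective, `R[1/a]` being the localization of `A` at the non-zero-divisor `φ a`);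
* `isNoetherianRing_away` — `A` is Noetherian when `R` is: it is of finite type over
  `(R[It])₀ ≅ R` (`HomogeneousLocalization.Away.finiteType`, `reesGrading.zeroEquiv`);
* `isDomain_away` — `A` is a domain when `R` is a domain and `a ≠ 0` (it embeds in `R[1/a]`);
* `charP_away` — `A` has characteristic `p` when `R` is a domain of characteristic `p` and `a ≠ 0`;
* `stub_reesChartRing` — the registered stub: the conjunction of the three.

References: The Stacks Project, Tag 0804 (affine blowup algebras `R[I/a]`, the image of `a` is a
non-zero-divisor and `R[I/a][1/a] = R[1/a]`); the rest is folklore commutative algebra.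
-/

-- single-problem summit: the doubled namespace component is forced
set_option linter.dupNamespace false

namespace Summit.ResolutionOfSingularities.ResolutionOfSingularities.Theorems.FInjectiveMacaulayfication.ReesChartRing

open Literature.AlgebraicGeometry.Resolution

variable {R : Type*} [CommRing R] {I : Ideal R} (a : R) (ha : a ∈ I)

/-- For a domain `R` and `0 ≠ a ∈ I`, the structure map `φ : R → (R[It])_{(at)}` of the chart ring
is injective: `ψ ∘ φ` is the injective localization map `R → R[1/a]`. [folklore] -/
theorem reesChartBase_injective [IsDomain R] (ha0 : a ≠ 0) :
    Function.Injective (reesChartBase a ha) := by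
  have hinj : Function.Injective (algebraMap R (Localization.Away a)) :=
    IsLocalization.injective (M := Submonoid.powers a) (Localization.Away a)
      (powers_le_nonZeroDivisors_of_noZeroDivisors ha0)
  rw [← reesChart_comp_reesChartBase a ha, RingHom.coe_comp] at hinj
  exact Function.Injective.of_comp hinj

/-- The chart ring `(R[It])_{(at)}` of a Noetherian ring `R` is Noetherian: it is of finite type over
the degree-zero piece `(R[It])₀ ≅ R`. [folklore] -/
theorem isNoetherianRing_away [IsNoetherianRing R] :
    IsNoetherianRing (HomogeneousLocalization.Away (reesGrading I) (reesT a ha)) := by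
  haveI : IsNoetherianRing (reesGrading I 0) :=
    isNoetherianRing_of_ringEquiv R (reesGrading.zeroEquiv I)
  haveI : Algebra.FiniteType (reesGrading I 0)
      (HomogeneousLocalization.Away (reesGrading I) (reesT a ha)) :=
    HomogeneousLocalization.Away.finiteType (reesT a ha) 1 (reesT_mem a ha)
  exact Algebra.FiniteType.isNoetherianRing (reesGrading I 0)
    (HomogeneousLocalization.Away (reesGrading I) (reesT a ha))

/-- The chart ring `(R[It])_{(at)}` of a domain `R` at `0 ≠ a ∈ I` is a domain: it embeds in
`R[1/a]` (a domain) by the injective chart map `reesChart` (`reesChart_injective` of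
`AffineBlowupAlgebra.lean`). [folklore] -/
theorem isDomain_away [IsDomain R] (ha0 : a ≠ 0) :
    IsDomain (HomogeneousLocalization.Away (reesGrading I) (reesT a ha)) := by
  haveI : IsDomain (Localization.Away a) :=
    IsLocalization.isDomain_localization (powers_le_nonZeroDivisors_of_noZeroDivisors ha0)
  exact Function.Injective.isDomain (reesChart a ha) (reesChart_injective a ha)

/-- The chart ring `(R[It])_{(at)}` of a domain `R` of characteristic `p` at `0 ≠ a ∈ I` has
characteristic `p` (`φ : R → (R[It])_{(at)}` is injective). [folklore] -/
theorem charP_away [IsDomain R] (ha0 : a ≠ 0) (p : ℕ) [CharP R p] :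
    CharP (HomogeneousLocalization.Away (reesGrading I) (reesT a ha)) p :=
  charP_of_injective_ringHom (reesChartBase_injective a ha ha0) p

/-- CHART RINGS (stub `stub_reesChartRing` of line `Sketch`): for a Noetherian domain `R` of
characteristic `p` and `0 ≠ a ∈ I`, the chart ring `(R[It])_{(at)} = R[I/a]` of `Bl_I(Spec R)` is a
Noetherian domain of characteristic `p` (finite type over `(R[It])₀ ≅ R`; embeds in `R[1/a]` as the
localization at the non-zero-divisor `a/1`). [folklore] -/
theorem stub_reesChartRing : ∀ (p : ℕ) [Fact p.Prime] (R : Type) [CommRing R] [IsDomain R] [IsNoetherianRing R]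
    [CharP R p] (I : Ideal R) (a : R) (ha : a ∈ I), a ≠ 0 →
    IsNoetherianRing (HomogeneousLocalization.Away (reesGrading I) (reesT a ha)) ∧
      IsDomain (HomogeneousLocalization.Away (reesGrading I) (reesT a ha)) ∧
      CharP (HomogeneousLocalization.Away (reesGrading I) (reesT a ha)) p := by
  intro p _ R _ _ _ _ I a ha ha0
  exact ⟨isNoetherianRing_away a ha, isDomain_away a ha ha0, charP_away a ha ha0 p⟩

end Summit.ResolutionOfSingularities.ResolutionOfSingularities.Theorems.FInjectiveMacaulayfication.ReesChartRing
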